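import Summits.BirchSwinnertonDyer.BirchSwinnertonDyer.Theorems.EisensteinPrimesBSDpOnCellCTelescopeK2CohomologyTransfer
import Summits.BirchSwinnertonDyer.BirchSwinnertonDyer.Theorems.EisensteinPrimesBSDpOnCellCTelescopeK2BigRepTransfer
import Summits.BirchSwinnertonDyer.BirchSwinnertonDyer.Theorems.EisensteinPrimesBSDpOnCellCTelescopeK2SelmerScalarTransport
import Summits.BirchSwinnertonDyer.BirchSwinnertonDyer.Theorems.EisensteinPrimesBSDpOnCellCTelescopeK2TorsionBigRepIdentification
import Summits.BirchSwinnertonDyer.BirchSwinnertonDyer.Theorems.BiquadraticEisensteinDescentEisensteinHeartFlatCMInertBadKPrimeCharIdealSlack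
import Summits.BirchSwinnertonDyer.BirchSwinnertonDyer.Theorems.ErratumRoadFiveSigmaLocalMultQuotient
import Literature.NumberTheory.EllipticCurves.BigRepModuleShapiroDualityProofs
import Literature.NumberTheory.EllipticCurves.Castella2018.SigmaSelmerUnramifiedOutsideSProofs
import HarnessLib

/-!
# Crux 4 `BSDpOnCellC` (stmt-BirchSwinnertonDyer-19034), line «telescope», leaf N2 sub-leaf W3 — THE TRANSPORT CORE:
# torsion of `Y = Sel(K, M[C c])^∨` and `p^e · char_Λ(Y) ⊆ Ch_Λ(X_ac(E))` from a quasi-isomorphism of coefficients `A[c] → E[p^∞]`,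
# the E-side finiteness + torsion of the UNRAMIFIED big Selmer dual, and finite generation of `Y`
# (successor LEAD `cruxlead-19034` g3; `--supports`, helper; THEOREMS ONLY; closes nothing)

HONEST FRAMING. No stub, no crux, no summit statement is proved; BSD is proved for no curve. This file is the ASSEMBLY of the four
transport bricks landed this generation (`…TelescopeK2CohomologyTransfer` p749172, `…TelescopeK2BigRepTransfer` p749312,
`…TelescopeK2SelmerScalarTransport` p749591, `…TelescopeK2TorsionBigRepIdentification` p749882) with the tree's char-ideal calculus
(`…CharIdealSlack.exists_span_pow_mul_charIdeal_le_of_ker`, `…CharIdealBaseChange.charIdeal_le_of_surjective/_of_injective`) and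
Shapiro duality (`SkinnerUrban2014.nonempty_linearEquiv_XAc_XBigDecomp`) into the statement that sub-leaf W3
(`K2Weight2.stub_weightTwoTransport`, `Cruxes/BSDpOnCellC/Lines/telescopeK2weight2.lean`) needs, in GENERIC coefficients.

SETTING (generic; in W3: `𝒪 = ℤ_p⟦X⟧`, `c = X`, `A = A₂` of leaf N1, `E = W.baseChange K`, `𝔮 = 𝔭̄`). `K` a totally complex number
field, `E/K` a Weierstrass curve, `κ` a `ℤ_p`-extension of `K` with topological generator `γ`, `𝔮` a prime of `K`; `𝒪` a
`ℤ_p`-algebra, `A` a discrete `𝒪`-module (with the compatible `ℤ_p`-structure), `ρ : ContinuousRep Γ_K 𝒪 A`, `c ∈ 𝒪`; a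
quasi-isomorphism of coefficients `θ₀ : A[c] →+ E[p^∞]` — `ℤ_p`-semilinear, `Γ_K`-equivariant for `torsionRep ρ c` and
`E.primaryTorsionGaloisRep p`, FINITE kernel and cokernel (the (fd₀)/(fd_k) clause of leaf N1); `Y := Sel_{strictSet p 𝔮 ∅}(K, M[C c])^∨`,
`M = AnticyclotomicBigGaloisRep κ ρ`, with ANY `Λ = ℤ_p⟦T⟧`-structure compatible with its `𝒪⟦T⟧`-structure (W3's binders).

* §1 `exists_pow_smul_eq_zero_of_finite` — a finite `ℤ_p`-module is killed by a power of `p` (the `ℤ_p` twin of the tree's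
  `exists_natCast_pow_smul_eq_zero_of_finite`).
* §2 **`isTorsion_and_charIdeal_le_of_quasiIso`** — INPUTS: (I-E) for every topology on `Λ` making `E[p^∞] ⊗ Λ^*` a topological module,
  the unramified big Selmer dual `X^{unr}(E) = XBig κ (E.primaryTorsionGaloisRep p) 𝔮 ∅` is finitely generated and torsion over `Λ`;
  (I-fg) `Y` is finitely generated over `Λ`. OUTPUT: `Y` is `Λ`-torsion and `(C p^e) · char_Λ(Y) ⊆ XAc.charIdeal E p κ 𝔮 ∅ γ` for some `e`
  — W3's second and third conjuncts. PROOF: `θ₀` is `ℤ_p`-linear with kernel killed by `p^{e₁}` and cokernel by `p^{e₂}` (§1), so `A[c]` is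
  `p`-primary and `torsionRep ρ c` restricts to a `ℤ_p`-linear `ρ₀` (`ContinuousRep.restrictScalars`; `ContinuousSMul` by
  `SigmaLocal.continuousSMul_padicInt_of_discrete`); with the DISCRETE topology on `Λ` (the statement mentions none — this is why the
  coefficients are kept generic: `𝒪` and `Λ` must not be the same type), brick 2 gives the big-module map `f : A[c] ⊗ Λ^* → E[p^∞] ⊗ Λ^*`
  with (hker)/(hcoker) for `a = C p^{e₁}`, `b = C p^{e₂}`; brick 1 gives `β = (Sel f)^∨ : X^{unr}(E) → Y''`, `Y'' = Sel(K, A[c] ⊗ Λ_{ℤ_p}^*)^∨`,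
  with `ker β` killed by `(ab)²` and `coker β` by `ab`; bricks 4 + 3 give `Y ≃ₗ[Λ] Y''`; then `Y''` is f.g. (from `Y`) and torsion (from
  `X^{unr}(E)` through `β`), `((ab)²)^m · char(Y'') ⊆ char(X^{unr}(E))` (slack socket), `char(X^{unr}(E)) ⊆ char(X^{dec}(E))` (the
  decomposition conditions imply the unramified ones, `Castella2018.resH1_comp_eq_zero_of_resH1_eq_zero`, so `X^{unr} ↠ X^{dec}`),
  `char(X^{dec}(E)) ⊆ char(X_ac(E)) = XAc.charIdeal` (Shapiro `X_ac ≃ₗ X^{dec}`), and `char(Y) ⊆ char(Y'')`.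

What W3 still needs beyond this core (successor / width seats): (I-E) on Cell C — `X_ac` torsion (tree `isTorsion_xAc_other_of_cellC` under
the telescope's PUB facts) + the Σ-change at the primes `w ∣ N` (tree `XBigDecomp.isTorsion_and_charIdeal_mul_span_prod_le` with the local
terms `moduleFinite_isTorsion_mem_charIdeal_dual_h1_bigRep_of_cofinitelyGenerated`) + `Sel^{unr,∅} ≤ Sel^{dec,S_N}` (`ℋ^{ur}_w = 0` at good
`w`: `resH1_localMap_inl_eq_zero_of_inr`, `bigRep_sub_self_surjective`) + finite generation (`TelescopeK2SelmerCofinite.module_finite_XBig`);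
and (I-fg) — W3's own first conjunct — by cofinite generation (same file). The W3-shaped kernel applying this core to `(ℤ_p⟦X⟧, X, A₂,
W.baseChange K, 𝔭̄)` is `…TelescopeK2WeightTwoTransportOfInputs`.

References: R. Greenberg, LNM 1716 (1999) §4 (control with bounded kernels/cokernels) [GreenbergLNM1716]; C. Skinner–E. Urban, Invent. Math.
195 (2014) §3.1–3.2 (Λ-adic Selmer groups, Prop. 3.2.3 Shapiro) [SkinnerUrban2014]; F. Castella, Camb. J. Math. 6 (2018) §2.1–2.2, Def. 2.2
(`X_ac`, the strict/unramified conditions) [Castella2018]; L. Washington, *Introduction to Cyclotomic Fields* §13.2 [Washington1997].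
-/

set_option autoImplicit false
set_option linter.dupNamespace false

noncomputable section

open scoped Classical

open CategoryTheory WeierstrassCurve NumberField IsDedekindDomain Field PowerSeries
  Literature.NumberTheory.EllipticCurves Literature.NumberTheory.EllipticCurves.GreenbergSelmer
  Literature.NumberTheory.GaloisRepresentations
  Literature.NumberTheory.EllipticCurves.BigGaloisRep
  Literature.NumberTheory.EllipticCurves.BigRepModule
  Summit.BirchSwinnertonDyer.Rank1Residual.X11b

namespace Summit.BirchSwinnertonDyer.BirchSwinnertonDyer.Theorems.TelescopeK2WeightTwoTransportCore

open Summit.BirchSwinnertonDyer.BirchSwinnertonDyer.Theorems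

/-! ## §1 A finite `ℤ_p`-module is killed by a power of `p` -/

/-- **A finite `ℤ_p`-module is killed by `p^a`** (`a = v_p(#F)`: `#F • y = 0`, `#F = p^a · u`, `u ∈ ℤ_pˣ`). One-variable-free twin of the
tree's `exists_natCast_pow_smul_eq_zero_of_finite` (for `Λ`-modules). [cite: Washington1997, §13.2] -/
theorem exists_pow_smul_eq_zero_of_finite {p : ℕ} [hp : Fact p.Prime] {F : Type*} [AddCommGroup F] [Module ℤ_[p] F]
    [Finite F] : ∃ a : ℕ, ∀ y : F, ((p : ℤ_[p]) ^ a) • y = 0 := by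
  have hN : Nat.card F ≠ 0 := Nat.card_pos.ne'
  obtain ⟨a, u, hu, hN'⟩ := Nat.exists_eq_pow_mul_and_not_dvd hN p hp.out.ne_one
  refine ⟨a, fun y => ?_⟩
  have hunit : IsUnit ((u : ℤ_[p])) := by
    rw [PadicInt.isUnit_iff]
    have hle := PadicInt.norm_le_one (u : ℤ_[p])
    have hlt : ¬ ‖(u : ℤ_[p])‖ < 1 := by
      rw [← Int.cast_natCast, PadicInt.norm_int_lt_one_iff_dvd, Int.natCast_dvd_natCast]
      exact hu
    exact le_antisymm hle (not_lt.mp hlt)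
  obtain ⟨w, hw⟩ := hunit
  have h1 : (w : ℤ_[p]) • (((p : ℤ_[p]) ^ a) • y) = 0 := by
    rw [hw, ← mul_smul, ← Nat.cast_pow, ← Nat.cast_mul, mul_comm, ← hN', Nat.cast_smul_eq_nsmul,
      card_nsmul_eq_zero']
  calc ((p : ℤ_[p]) ^ a) • y
      = ((↑w⁻¹ : ℤ_[p]) * (w : ℤ_[p])) • (((p : ℤ_[p]) ^ a) • y) := by rw [Units.inv_mul, one_smul]
    _ = 0 := by rw [mul_smul, h1, smul_zero]

/-! ## §2 The core -/

variable {K : Type} [Field K] [NumberField K] {p : ℕ} [Fact p.Prime]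
  {𝒪 : Type} [CommRing 𝒪] [Algebra ℤ_[p] 𝒪] [TopologicalSpace 𝒪]
  {A : Type} [AddCommGroup A] [Module 𝒪 A] [Module ℤ_[p] A] [IsScalarTower ℤ_[p] 𝒪 A]
  [TopologicalSpace A] [DiscreteTopology A]
  [TopologicalSpace (PowerSeries 𝒪)] [ContinuousSMul (PowerSeries 𝒪) (BigRepModule 𝒪 p A)]

set_option maxHeartbeats 1600000 in
/-- **THE W3 TRANSPORT CORE.** For a totally complex `K`, `E/K`, a `ℤ_p`-extension `κ` with topological generator `γ`, a prime `𝔮`, a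
`ℤ_p`-algebra `𝒪`, a discrete `𝒪`-module `A` with continuous `𝒪`-linear `Γ_K`-action `ρ`, `c ∈ 𝒪`, and a `ℤ_p`-semilinear `Γ_K`-equivariant
`θ₀ : A[c] →+ E[p^∞]` with finite kernel and cokernel: IF the unramified big Selmer dual `XBig κ (E.primaryTorsionGaloisRep p) 𝔮 ∅` is finitely
generated and torsion over `Λ = ℤ_p⟦T⟧` (for every admissible topology on `Λ`) AND `Y = Sel_{strictSet p 𝔮 ∅}(K, (A ⊗ Λ_𝒪^*)[C c])^∨` is finitely
generated over `Λ` (for the given compatible `Λ`-structure), THEN `Y` is `Λ`-torsion and `(C p^e) · char_Λ(Y) ⊆ XAc.charIdeal E p κ 𝔮 ∅ γ` for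
some `e` — the torsion and char-ideal conjuncts of W3 `K2Weight2.stub_weightTwoTransport` in generic coefficients. See the module docstring
for the proof route through the four landed bricks. [cite: GreenbergLNM1716, §4] [cite: SkinnerUrban2014, Prop. 3.2.3 and §3.1.6]
[cite: Castella2018, Def. 2.2 and §2.2] -/
theorem isTorsion_and_charIdeal_le_of_quasiIso [IsTotallyComplex K] (E : WeierstrassCurve K)
    (κ : ZpExtension K p) (γ : absoluteGaloisGroup K) [Fact (κ.IsTopGenerator γ)]
    (𝔮 : HeightOneSpectrum (𝓞 K)) (ρ : ContinuousRep (absoluteGaloisGroup K) 𝒪 A) (c : 𝒪)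
    (θ₀ : Submodule.torsionBy 𝒪 A c →+ PrimaryTorsion (geomPoints E) p)
    (hθ₀C : ∀ (r : ℤ_[p]) (a : Submodule.torsionBy 𝒪 A c), θ₀ (algebraMap ℤ_[p] 𝒪 r • a) = r • θ₀ a)
    (hθ₀G : ∀ (σ : absoluteGaloisGroup K) (a : Submodule.torsionBy 𝒪 A c),
      θ₀ (TorsionControl.torsionRep ρ c σ a) = E.primaryTorsionGaloisRep p σ (θ₀ a))
    (hker : Finite θ₀.ker) (hcoker : Finite (PrimaryTorsion (geomPoints E) p ⧸ θ₀.range))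
    (hE : ∀ [TopologicalSpace (PowerSeries ℤ_[p])]
      [ContinuousSMul (PowerSeries ℤ_[p]) (BigRepModule ℤ_[p] p (PrimaryTorsion (geomPoints E) p))],
      Module.Finite (PowerSeries ℤ_[p])
          (XBig κ (E.primaryTorsionGaloisRep p) 𝔮 (∅ : Set (HeightOneSpectrum (𝓞 K)))) ∧
        Module.IsTorsion (PowerSeries ℤ_[p])
          (XBig κ (E.primaryTorsionGaloisRep p) 𝔮 (∅ : Set (HeightOneSpectrum (𝓞 K)))))
    [Module (PowerSeries ℤ_[p]) (CharacterModule (TorsionControl.selmer (localMap K)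
      (strictSet p 𝔮 (∅ : Set (HeightOneSpectrum (𝓞 K))))
      (TorsionControl.torsionRep (AnticyclotomicBigGaloisRep κ ρ) (PowerSeries.C c))))]
    [IsScalarTower (PowerSeries ℤ_[p]) (PowerSeries 𝒪) (CharacterModule (TorsionControl.selmer (localMap K)
      (strictSet p 𝔮 (∅ : Set (HeightOneSpectrum (𝓞 K))))
      (TorsionControl.torsionRep (AnticyclotomicBigGaloisRep κ ρ) (PowerSeries.C c))))]
    (hfgY : Module.Finite (PowerSeries ℤ_[p]) (CharacterModule (TorsionControl.selmer (localMap K)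
      (strictSet p 𝔮 (∅ : Set (HeightOneSpectrum (𝓞 K))))
      (TorsionControl.torsionRep (AnticyclotomicBigGaloisRep κ ρ) (PowerSeries.C c))))) :
    Module.IsTorsion (PowerSeries ℤ_[p]) (CharacterModule (TorsionControl.selmer (localMap K)
        (strictSet p 𝔮 (∅ : Set (HeightOneSpectrum (𝓞 K))))
        (TorsionControl.torsionRep (AnticyclotomicBigGaloisRep κ ρ) (PowerSeries.C c)))) ∧
      ∃ e : ℕ, Ideal.span {PowerSeries.C ((p : ℤ_[p]) ^ e)} *
          Literature.NumberTheory.EllipticCurves.Module.charIdeal (PowerSeries ℤ_[p])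
            (CharacterModule (TorsionControl.selmer (localMap K)
              (strictSet p 𝔮 (∅ : Set (HeightOneSpectrum (𝓞 K))))
              (TorsionControl.torsionRep (AnticyclotomicBigGaloisRep κ ρ) (PowerSeries.C c)))) ≤
        Castella2018.AcSelmer.XAc.charIdeal E p κ 𝔮 ∅ γ := by
  -- abbreviations
  set Ac : Type := ↥(Submodule.torsionBy 𝒪 A c) with hAc
  set Ep : Type := PrimaryTorsion (geomPoints E) p with hEp
  set Y : Type := CharacterModule (TorsionControl.selmer (localMap K)
      (strictSet p 𝔮 (∅ : Set (HeightOneSpectrum (𝓞 K))))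
      (TorsionControl.torsionRep (AnticyclotomicBigGaloisRep κ ρ) (PowerSeries.C c))) with hY
  /- §a `θ₀` as a `ℤ_p`-linear map; kernel killed by `p^e₁`, cokernel by `p^e₂`; `A[c]` is `p`-primary -/
  let θ : Ac →ₗ[ℤ_[p]] Ep :=
    { toFun := θ₀
      map_add' := θ₀.map_add
      map_smul' := fun r a => by
        rw [RingHom.id_apply, ← hθ₀C, algebraMap_smul] }
  have hθ : ∀ a, θ a = θ₀ a := fun _ => rfl
  haveI : Finite (LinearMap.ker θ) := by
    have : (LinearMap.ker θ : Set Ac) = (θ₀.ker : Set Ac) := by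
      ext a
      change a ∈ LinearMap.ker θ ↔ a ∈ θ₀.ker
      rw [LinearMap.mem_ker, AddMonoidHom.mem_ker, hθ]
    exact Finite.of_equiv θ₀.ker (Equiv.setCongr this.symm)
  obtain ⟨e₁, he₁⟩ := exists_pow_smul_eq_zero_of_finite (p := p) (F := LinearMap.ker θ)
  have hkerθ : ∀ a : Ac, θ a = 0 → ((p : ℤ_[p]) ^ e₁) • a = 0 := fun a ha =>
    congrArg Subtype.val (he₁ ⟨a, ha⟩)
  haveI : Finite (Ep ⧸ LinearMap.range θ) := by
    have hr : (LinearMap.range θ).toAddSubgroup = θ₀.range := by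
      ext y
      change y ∈ LinearMap.range θ ↔ y ∈ θ₀.range
      rw [LinearMap.mem_range, AddMonoidHom.mem_range]
      exact ⟨fun ⟨a, ha⟩ => ⟨a, ha⟩, fun ⟨a, ha⟩ => ⟨a, ha⟩⟩
    exact Finite.of_equiv (Ep ⧸ θ₀.range)
      (QuotientAddGroup.quotientAddEquivOfEq hr.symm).toEquiv
  obtain ⟨e₂, he₂⟩ := exists_pow_smul_eq_zero_of_finite (p := p) (F := Ep ⧸ LinearMap.range θ)
  have hcokerθ : ∀ y : Ep, ∃ a : Ac, θ a = ((p : ℤ_[p]) ^ e₂) • y := fun y => by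
    have h := he₂ (Submodule.Quotient.mk y)
    rw [← Submodule.Quotient.mk_smul, Submodule.Quotient.mk_eq_zero] at h
    obtain ⟨a, ha⟩ := h
    exact ⟨a, ha⟩
  have hAc : ∀ a : Ac, ∃ k : ℕ, p ^ k • a = 0 := fun a => by
    obtain ⟨k, hk⟩ := PrimaryTorsion.exists_pow_smul_eq_zero (θ a)
    refine ⟨k + e₁, ?_⟩
    have h1 : θ (((p : ℤ_[p]) ^ k) • a) = 0 := by
      rw [map_smul, PrimaryTorsion.pow_smul_eq_zero_of _ hk]
    have h2 := hkerθ _ h1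
    rw [← mul_smul, ← pow_add, add_comm] at h2
    rw [← Nat.cast_smul_eq_nsmul ℤ_[p], Nat.cast_pow]
    exact h2
  /- §b the `ℤ_p`-linear torsion representation `ρ₀` on `A[c]` -/
  haveI : ContinuousSMul ℤ_[p] Ac := SigmaLocal.continuousSMul_padicInt_of_discrete hAc
  let ρ₀ : ContinuousRep (absoluteGaloisGroup K) ℤ_[p] Ac :=
    (TorsionControl.torsionRep ρ c).restrictScalars ℤ_[p]
  have hρ₀ : ∀ (g : absoluteGaloisGroup K) (a : Ac), ((ρ₀ g a : Ac) : A) = ρ g a := fun g a => rfl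
  have hθG : ∀ (g : absoluteGaloisGroup K) (a : Ac), θ (ρ₀ g a) = E.primaryTorsionGaloisRep p g (θ a) :=
    fun g a => hθ₀G g a
  /- §c the `Λ = ℤ_p⟦T⟧` side: discrete topology on `Λ` (the statement does not mention one), big representations of `ρ₀`
     and of `E[p^∞]`, and the bricks -/
  letI τΛ : TopologicalSpace (PowerSeries ℤ_[p]) := ⊥
  haveI : DiscreteTopology (PowerSeries ℤ_[p]) := ⟨rfl⟩
  set ρE := E.primaryTorsionGaloisRep p with hρE
  -- brick 2: the big-module map induced by `θ`
  obtain ⟨f, hf, hfker, hfcoker⟩ :=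
    TelescopeK2BigRepTransfer.exists_hom_bigRep_of_coefficients (p := p) κ.toContinuousMonoidHom ρ₀ ρE θ hθG
      (c₁ := (p : ℤ_[p]) ^ e₁) (c₂ := (p : ℤ_[p]) ^ e₂) hkerθ hcokerθ hAc
  -- brick 1: the dual Selmer transfer `β = (Sel f)^∨ : X^{unr}(E) → Y''`
  obtain ⟨β, -, hβker, hβcoker⟩ :=
    TelescopeK2CohomologyTransfer.exists_dual_selmer_transfer (localMap K)
      (strictSet p 𝔮 (∅ : Set (HeightOneSpectrum (𝓞 K)))) f hfker hfcoker
  -- bricks 4 + 3: `Y ≃ₗ[Λ] Y''`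
  obtain ⟨η, -, hηG, hησ⟩ :=
    TelescopeK2TorsionBigRepIdentification.exists_torsion_bigRep_addEquiv (R := ℤ_[p]) (p := p)
      κ.toContinuousMonoidHom ρ c ρ₀ hρ₀
  obtain ⟨D⟩ := TelescopeK2SelmerScalarTransport.nonempty_dual_linearEquiv (localMap K)
      (strictSet p 𝔮 (∅ : Set (HeightOneSpectrum (𝓞 K))))
      (bigRep (p := p) κ.toContinuousMonoidHom ρ₀)
      (TorsionControl.torsionRep (AnticyclotomicBigGaloisRep κ ρ) (PowerSeries.C c)) η hηG hησ
  -- the E-side input at the discrete topology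
  obtain ⟨hfgE, htorE⟩ := hE
  /- §d algebra over `Λ = ℤ_p⟦T⟧` -/
  set a : PowerSeries ℤ_[p] := PowerSeries.C ((p : ℤ_[p]) ^ e₁) with ha
  set b : PowerSeries ℤ_[p] := PowerSeries.C ((p : ℤ_[p]) ^ e₂) with hb
  have hab0 : a * b ≠ 0 := by
    rw [ha, hb, ← map_mul, ← pow_add]
    intro h
    have h1 := congrArg (PowerSeries.constantCoeff (R := ℤ_[p])) h
    rw [PowerSeries.constantCoeff_C, map_zero] at h1
    exact pow_ne_zero _ (Nat.cast_ne_zero.mpr (Fact.out : p.Prime).ne_zero) h1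
  -- `Y''` is finitely generated (from `Y` along `D`) and torsion (from `X^{unr}(E)` along `β`)
  haveI hfgY'' : Module.Finite (PowerSeries ℤ_[p]) (CharacterModule (TorsionControl.selmer (localMap K)
        (strictSet p 𝔮 (∅ : Set (HeightOneSpectrum (𝓞 K)))) (bigRep (p := p) κ.toContinuousMonoidHom ρ₀))) := Module.Finite.equiv D
  have htorY'' : Module.IsTorsion (PowerSeries ℤ_[p]) (CharacterModule (TorsionControl.selmer (localMap K)
        (strictSet p 𝔮 (∅ : Set (HeightOneSpectrum (𝓞 K)))) (bigRep (p := p) κ.toContinuousMonoidHom ρ₀))) := by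
    intro χ
    obtain ⟨χE, hχE⟩ := LinearMap.mem_range.1 (hβcoker χ)
    obtain ⟨⟨d, hd⟩, hdχ⟩ := @htorE χE
    refine ⟨⟨d * (a * b), mul_mem hd (mem_nonZeroDivisors_of_ne_zero hab0)⟩, ?_⟩
    change (d * (a * b)) • χ = 0
    change d • χE = 0 at hdχ
    rw [mul_smul, ← hχE, ← map_smul, hdχ, map_zero]
  -- `((ab)²)^m · char(Y'') ⊆ char(X^{unr}(E))`
  obtain ⟨m, hm⟩ :=
    BiquadraticEisensteinDescentEisensteinHeartFlatCMInertBadKPrimeCharIdealSlack.exists_span_pow_mul_charIdeal_le_of_ker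
      htorY'' htorE β ((a * b) ^ 2) (fun χ => Subtype.ext (hβker χ.1 χ.2))
  -- `X^{unr}(E) ↠ X^{dec}(E)`: the decomposition conditions imply the unramified ones
  have hle : selmerBigDecomp κ ρE 𝔮 (∅ : Set (HeightOneSpectrum (𝓞 K))) ≤
      selmerBig κ ρE 𝔮 (∅ : Set (HeightOneSpectrum (𝓞 K))) := by
    intro z hz
    rw [mem_selmerBig_iff]
    have hz' := (BigGaloisRep.mem_selmer_iff (localMap K) _ _ z).1 hz
    refine ⟨hz' (Sum.inl 𝔮) (Or.inl rfl), fun w hw hwp => ?_⟩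
    exact Castella2018.resH1_comp_eq_zero_of_resH1_eq_zero _ _ (inertiaIncl K w) z
      (hz' (Sum.inl w) (Or.inr ⟨hw, hwp⟩))
  let π : (XBig κ ρE 𝔮 (∅ : Set (HeightOneSpectrum (𝓞 K)))) →ₗ[PowerSeries ℤ_[p]] (XBigDecomp κ ρE 𝔮 (∅ : Set (HeightOneSpectrum (𝓞 K)))) :=
    CharacterModule.dual (Submodule.inclusion hle)
  have hπ : Function.Surjective π :=
    CharacterModule.dual_surjective_of_injective _ (Submodule.inclusion_injective hle)
  have h2 : Literature.NumberTheory.EllipticCurves.Module.charIdeal (PowerSeries ℤ_[p]) (XBig κ ρE 𝔮 (∅ : Set (HeightOneSpectrum (𝓞 K)))) ≤ Literature.NumberTheory.EllipticCurves.Module.charIdeal (PowerSeries ℤ_[p]) (XBigDecomp κ ρE 𝔮 (∅ : Set (HeightOneSpectrum (𝓞 K)))) :=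
    BiquadraticEisensteinDescentEisensteinHeartFlatCMInertBadKPrimeCharIdealBaseChange.charIdeal_le_of_surjective
      htorE π hπ
  haveI : Module.Finite (PowerSeries ℤ_[p]) (XBigDecomp κ ρE 𝔮 (∅ : Set (HeightOneSpectrum (𝓞 K)))) := Module.Finite.of_surjective π hπ
  have htorDec : Module.IsTorsion (PowerSeries ℤ_[p]) (XBigDecomp κ ρE 𝔮 (∅ : Set (HeightOneSpectrum (𝓞 K)))) := by
    intro z
    obtain ⟨y, rfl⟩ := hπ z
    obtain ⟨d, hd⟩ := @htorE y
    exact ⟨d, by rw [Submonoid.smul_def, ← map_smul, ← Submonoid.smul_def, hd, map_zero]⟩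
  -- `X^{dec}(E) ≃ₗ[Λ] X_ac(E)` (Shapiro, tree) and its char-ideal consequence
  obtain ⟨eAc⟩ := SkinnerUrban2014.nonempty_linearEquiv_XAc_XBigDecomp E p κ 𝔮
    (∅ : Set (HeightOneSpectrum (𝓞 K))) γ
  have h3 : Literature.NumberTheory.EllipticCurves.Module.charIdeal (PowerSeries ℤ_[p]) (XBigDecomp κ ρE 𝔮 (∅ : Set (HeightOneSpectrum (𝓞 K)))) ≤ Castella2018.AcSelmer.XAc.charIdeal E p κ 𝔮 ∅ γ :=
    BiquadraticEisensteinDescentEisensteinHeartFlatCMInertBadKPrimeCharIdealBaseChange.charIdeal_le_of_injective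
      htorDec eAc.toLinearMap eAc.injective
  -- `Y` versus `Y''` along `D`
  have htorY : Module.IsTorsion (PowerSeries ℤ_[p]) Y := by
    intro y
    obtain ⟨d, hd⟩ := @htorY'' (D y)
    refine ⟨d, D.injective ?_⟩
    rw [Submonoid.smul_def, map_smul, map_zero, ← Submonoid.smul_def, hd]
  haveI : Module.Finite (PowerSeries ℤ_[p]) Y := hfgY
  have h0 : Literature.NumberTheory.EllipticCurves.Module.charIdeal (PowerSeries ℤ_[p]) Y ≤ Literature.NumberTheory.EllipticCurves.Module.charIdeal (PowerSeries ℤ_[p]) (CharacterModule (TorsionControl.selmer (localMap K)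
        (strictSet p 𝔮 (∅ : Set (HeightOneSpectrum (𝓞 K)))) (bigRep (p := p) κ.toContinuousMonoidHom ρ₀))) :=
    BiquadraticEisensteinDescentEisensteinHeartFlatCMInertBadKPrimeCharIdealBaseChange.charIdeal_le_of_injective
      htorY D.symm.toLinearMap D.symm.injective
  -- assemble
  refine ⟨htorY, (e₁ + e₂) * (2 * m), ?_⟩
  have hx : ((a * b) ^ 2) ^ m = PowerSeries.C ((p : ℤ_[p]) ^ ((e₁ + e₂) * (2 * m))) := by
    rw [ha, hb, ← map_mul, ← pow_add, ← map_pow, ← map_pow, ← pow_mul, ← pow_mul]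
  calc Ideal.span {PowerSeries.C ((p : ℤ_[p]) ^ ((e₁ + e₂) * (2 * m)))} * Literature.NumberTheory.EllipticCurves.Module.charIdeal (PowerSeries ℤ_[p]) Y
      ≤ Ideal.span {PowerSeries.C ((p : ℤ_[p]) ^ ((e₁ + e₂) * (2 * m)))} * Literature.NumberTheory.EllipticCurves.Module.charIdeal (PowerSeries ℤ_[p]) (CharacterModule (TorsionControl.selmer (localMap K)
        (strictSet p 𝔮 (∅ : Set (HeightOneSpectrum (𝓞 K)))) (bigRep (p := p) κ.toContinuousMonoidHom ρ₀))) :=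
        Ideal.mul_mono_right h0
    _ = Ideal.span {((a * b) ^ 2) ^ m} * Literature.NumberTheory.EllipticCurves.Module.charIdeal (PowerSeries ℤ_[p]) (CharacterModule (TorsionControl.selmer (localMap K)
        (strictSet p 𝔮 (∅ : Set (HeightOneSpectrum (𝓞 K)))) (bigRep (p := p) κ.toContinuousMonoidHom ρ₀))) := by rw [hx]
    _ ≤ Literature.NumberTheory.EllipticCurves.Module.charIdeal (PowerSeries ℤ_[p]) (XBig κ ρE 𝔮 (∅ : Set (HeightOneSpectrum (𝓞 K)))) := hm
    _ ≤ _ := h2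
    _ ≤ _ := h3

end Summit.BirchSwinnertonDyer.BirchSwinnertonDyer.Theorems.TelescopeK2WeightTwoTransportCore

end
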